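import Mathlib
import HarnessLib
import Literature.NumberTheory.DiophantineGeometry.FunctionFieldGenus

/-!
# The `n`-term `S`-unit equation over function fields (Zannier 1993, Thm. 1 and Corollary;
# Voloch 1985 / Brownawell–Masser 1986)

Trunk `Literature/NumberTheory/DiophantineGeometry` (function fields of one variable over the
tree's interface `IsAlgFunctionField`, `AlgFunctionField.PlaceOver`, `PlaceOver.ord`,
`PlaceOver.degree`, `AlgFunctionField.genus`; sibling of `MasonFundamentalInequality.lean`
(the case `n = 3`) and `FunctionFieldGCD.lean`, same conventions).

U. Zannier, *Some remarks on the `S`-unit equation in function fields*, Acta Arith. 64 (1993),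
no. 1, 87–98 [Zannier1993] (open access; read from the journal PDF, pp. 87–88 and 92–93):

* p. 87: "Let `k` be an algebraically closed field of zero characteristic, `K` a function field in
  one variable over `k`, of genus `g`. For `n ≥ 2`, `u₁, …, uₙ ∈ K` not all zero, we define the
  projective height as usual: (1) `H(u₁, …, uₙ) = −Σ_v min(v(u₁), …, v(uₙ))` where `v`
  (normalized so that `v(K^*) = ℤ`) runs over all places of `K/k`." Footnote (4), p. 88:
  `S`-units, "That is, `v(aᵢ) = 0` for `v ∉ S`."
* p. 88, (3)–(4): Voloch 1985 and Brownawell–Masser 1986 (Corollary 1 to their Theorem A):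
  if `u₁ + … + uₙ = 0` (`n ≥ 3`) and no proper nonempty subsum vanishes [and the `uᵢ` are
  `S`-units], then `H(u₁, …, uₙ) ≤ C(n−1, 2)·(#S + 2g − 2)`; Zannier's sharpening (4):
  `H(u₁, …, uₙ) ≤ C(μ, 2)·(#S + 2g − 2)`, "where `μ` is the dimension of the vector space spanned
  by the `uᵢ` over `k`."
* **Theorem 1** (p. 88). "Let `a₁, …, aₙ ∈ K` be `S`-units such that `Σ_{i∈Γ} aᵢ ≠ 0` for every
  nonempty `Γ ⊂ {1, …, n}`. Put `b = a₁ + … + aₙ`. Then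
  `Σ_{v∈S} (v(b) − min v(aᵢ)) ≤ C(μ, 2)·(#S + 2g − 2)` where `μ = dim Σ k aᵢ`.
  (Now, unlike the previous statements, `b` is not necessarily an `S`-unit.)"
* **Corollary** (p. 92). "If `u₁ + … + uₙ = 0` but no proper subsum of the `uᵢ` vanishes, then,
  provided the `uᵢ` are `S`-units, inequality (4) holds." (Proof p. 93: Theorem 1 with `n − 1`
  in place of `n`, `b = −uₙ`.)

(`C(m, 2) = m(m−1)/2`. For `n = 3`, `μ ≤ 2`, the Corollary is Mason's inequality
`H ≤ #S + 2g − 2`, cf. `Mason1984_lemma2`; Mason's general-`n` Lemma had `4^{n−2}` in place of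
`C(n−1,2)` (p. 87 (2)). Brownawell–Masser's Theorems A–B [Math. Proc. Cambridge Philos. Soc. 100
(1986) 427–434, doi:10.1017/S0305004100066184 — paywalled, acquisition request acq-03844] are
finer place by place; their Corollary 1 is (3), i.e. the case `μ = n − 1` bound of the Corollary
below, so nothing printed there is lost at the level stated here.)

Vendored here AS PRINTED as NAMED FACTS (`def … : Prop`, review-queued, no proof). Rendering over
the tree's interface: `k` algebraically closed of characteristic zero, `F/k` an algebraic function
field of one variable, places `PlaceOver k F` — all of degree `1` over an algebraically closed
constant field, so the degree weights written below (the spelling of `Mason1984_lemma2` and of the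
ABC route heights) change nothing —, `S : Finset (PlaceOver k F)`, tuples `a : Fin n → F` of
NON-ZERO `S`-units (`ord_v (a i) = 0` off `S`), `μ = finrank_k (span_k {aᵢ})`, the minimum over
the finite nonempty index set as an `iInf` in `ℤ` (`0 < n` is assumed in Theorem 1, where it is
implicit in print; the Corollary needs `2 ≤ n` for "`n ≥ 2`" of p. 87), `H` as the finitely
supported sum over all places of `deg v · max_i(−ord_v uᵢ) = −deg v · min_i ord_v uᵢ`.

Relevance: these are the "`n`-term `S`-unit / Brownawell–Masser shapes" — LINEAR-in-genus
universal height laws of complex function fields in several variables — named in the kill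
criteria of the ABC route `Summits/ABC/ABC/Theses/GvfSupportTransfer.lean` (items
`LinearLawTransfer`, `GenusNegligibleDensity`) and behind `Literature.Barriers.ABC.NConjectureExponentSharp`
(Browkin–Brzeziński vs. the sharp function-field exponent). No Mathlib or tree declaration states
an `n`-term unit-equation height bound for `n > 3` (searched `Brownawell`, `Voloch`, `Zannier1993`,
`unit equation.*genus`: only the `n = 3` Mason fact and the number-field finiteness files
`UnitEquationFinite*.lean`).
-/

namespace Literature.NumberTheory.DiophantineGeometry

open AlgFunctionField

/-- **Zannier 1993, Theorem 1** (Acta Arith. 64 (1993) 87–98, p. 88). Let `k` be algebraically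
closed of characteristic zero, `F/k` a function field of one variable of genus `g`, `S` a finite
set of places and `a₁, …, aₙ ∈ F` (`n ≥ 1`) non-zero `S`-units (all zeros and poles in `S`) such
that NO nonempty subsum `Σ_{i∈Γ} aᵢ` vanishes; put `b = a₁ + … + aₙ` (`≠ 0`, not necessarily an
`S`-unit) and `μ = dim_k span_k{a₁, …, aₙ}`. Then
`Σ_{v∈S} (ord_v b − min_i ord_v aᵢ) ≤ C(μ,2)·(#S + 2g − 2)`.
Written with place degrees (all `1` over an algebraically closed constant field), as in
`Mason1984_lemma2`. A named fact: users take `(h : Zannier1993_thm1)`.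
[cite: Zannier1993, Thm 1] -/
def Zannier1993_thm1 : Prop :=
  ∀ (k : Type) [Field k] [IsAlgClosed k] [CharZero k] (F : Type) [Field F] [Algebra k F]
    [IsAlgFunctionField k F] (S : Finset (PlaceOver k F)) (n : ℕ) (a : Fin n → F),
    0 < n → (∀ i, a i ≠ 0) → (∀ (v : PlaceOver k F) (i : Fin n), v ∉ S → v.ord (a i) = 0) →
    (∀ Γ : Finset (Fin n), Γ.Nonempty → ∑ i ∈ Γ, a i ≠ 0) →
    (∑ v ∈ S, (v.degree : ℤ) * (v.ord (∑ i, a i) - ⨅ i, v.ord (a i))) ≤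
      (Nat.choose (Module.finrank k (Submodule.span k (Set.range a))) 2 : ℤ) *
        ((S.card : ℤ) + (2 * (genus k F : ℤ) - 2))

/-- **Zannier 1993, Corollary** (Acta Arith. 64 (1993) 87–98, p. 92, inequality (4) p. 88; the case
`μ = n − 1` is Voloch 1985 / Brownawell–Masser 1986, Cor. 1 to Thm. A, inequality (3)). Let `k`
be algebraically closed of characteristic zero, `F/k` a function field of one variable of genus
`g`, `S` a finite set of places, `n ≥ 2` and `u₁, …, uₙ ∈ F` non-zero `S`-units with
`u₁ + … + uₙ = 0` such that no PROPER nonempty subsum vanishes. Then the projective height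
`H(u₁, …, uₙ) = −Σ_v min_i ord_v uᵢ` (p. 87 (1); all places, finitely supported) satisfies
`H(u₁, …, uₙ) ≤ C(μ,2)·(#S + 2g − 2)`, `μ = dim_k span_k{u₁, …, uₙ}` (`≤ n − 1`). For `n = 3`
this is Mason's `H ≤ #S + 2g − 2` (`Mason1984_lemma2`). Degree weights as above (all `1`).
The `n`-term function-field `abc` referred to by
`Summit.ABC.ABC.Theses.GvfSupportTransfer.LinearLawTransfer`. A named fact: users take
`(h : Zannier1993_cor)`. [cite: Zannier1993, Corollary p. 92] -/
def Zannier1993_cor : Prop :=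
  ∀ (k : Type) [Field k] [IsAlgClosed k] [CharZero k] (F : Type) [Field F] [Algebra k F]
    [IsAlgFunctionField k F] (S : Finset (PlaceOver k F)) (n : ℕ) (u : Fin n → F),
    2 ≤ n → (∀ i, u i ≠ 0) → (∀ (v : PlaceOver k F) (i : Fin n), v ∉ S → v.ord (u i) = 0) →
    ∑ i, u i = 0 →
    (∀ Γ : Finset (Fin n), Γ.Nonempty → Γ ≠ Finset.univ → ∑ i ∈ Γ, u i ≠ 0) →
    (∑ᶠ v : PlaceOver k F, -((v.degree : ℤ) * ⨅ i, v.ord (u i))) ≤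
      (Nat.choose (Module.finrank k (Submodule.span k (Set.range u))) 2 : ℤ) *
        ((S.card : ℤ) + (2 * (genus k F : ℤ) - 2))

end Literature.NumberTheory.DiophantineGeometry
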